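import Mathlib
import Summits.Parity.BatemanHorn.Theses.PolynomialMobius
import Summits.Parity.BatemanHorn.Theorems.IsogenyRedeiTypeIMainTerm
import Summits.Parity.BatemanHorn.Theorems.PolynomialMobiusPolyMobiusTailStubWindowSwap
import Summits.Parity.BatemanHorn.Theorems.PolynomialMobiusPolyMobiusTailStubWindowMainTerm
import Summits.Parity.BatemanHorn.Theorems.PolynomialMobiusPolyMobiusTailStubWindowBlocks
import HarnessLib

/-!
# Crux `PolyMobiusTail` (stmt-Parity-0870), line `stub_window_nonlinear`:
# W1 `stub_nonlinear_window_of_level` — the TRANSFER "signed level of distribution at the diagonal ⟹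
# uniform window" for systems with a non-linear member (registered stub; lead prover-line-stmt-Parity-0870-c8-0)

Registered skeleton `Cruxes/PolyMobiusTail/Lines/stub_window_nonlinear.lean` (planner-skel, 2026-08-17T13:18Z)
decomposes the window stub S3u of line `eta-free-multilinear-window` into W1 (this file) ∧ W2
`stub_single_nonlinear_level` ∧ W3 `stub_multi_nonlinear_level`.  W1 says: for a Bateman–Horn system
`f` with a member of degree `≥ 2`, IF there are `c > 0`, `A > 1`, `x₀` such that for all real `x ≥ x₀`
and all blocks `x^{1-c} ≤ D ≤ D' ≤ 2D`, `D ≤ x^{1+c}`,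
`|Σ_{d : D < ∏dᵢ ≤ D'} (∏ μ(dᵢ) log dᵢ) (A_d(x) − x·G(d))| ≤ x/(log x)^A`
(`A_d(x) = #{1 ≤ n ≤ x : dᵢ ∈ divisors(fᵢ(n)⁺) ∀ i}`, `G = TypeIMainTerm.sysDensity f`), THEN there is
`c' ∈ (0,1)` such that the window `Σ_{n≤x} Σ_{dᵢ∣fᵢ(n)⁺, x^{1-η} < ∏dᵢ ≤ x^{1+θ}} ∏ μ(dᵢ) log dᵢ` is
`o(x)` for all `θ, η ∈ (0, c']`.

Proof (every input landed): (1) exact swap of the two finite sums (`stub_windowSwap`, p166182):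
window `= Σ_{d ∈ [1,⌊U⌋]^k} [L < ∏dᵢ ≤ U] w(d) A_d(x)`, `L = x^{1-η}`, `U = x^{1+θ}`; (2) `A_d = x·G(d) +
(A_d − x·G(d))`; the main term `x · Σ_window w G` is `o(x)` (`stub_windowMainTerm`, p166444: a block of the
tail of the convergent log-weighted singular series, `TypeIMainTerm.tendsto_singularSeries`); (3) the
discrepancy sum is cut into `J = ⌈(θ+η) log x / log 2⌉` dyadic blocks `(c_j, c_{j+1}]`,
`c_j = min(L·2^j, U)` (`stub_windowBlocks`, p166244), each block moved to its own box
(`stub_windowBoxChange`) and bounded by the hypothesis, total `≤ (log x/log 2 + 1) · x/(log x)^A = o(x)`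
since `A > 1` (`blocks_majorant_isLittleO`); `c' = min(c, 1/2)`.
-/

open Finset Filter Asymptotics Polynomial ArithmeticFunction
open scoped Topology ArithmeticFunction.Moebius

namespace Summit.Parity.BatemanHorn.Theorems.PolyMobiusTail.NonlinearWindow

open Literature.NumberTheory.Sieve
open Summit.Parity.BatemanHorn.Theorems.TypeIMainTerm (sysDensity)

/-- The number of dyadic blocks and the resulting error majorant are `o(x)`:
`((log x / log 2) + 1) · x / (log x)^A = o(x)` for `A > 1`. -/
theorem blocks_majorant_isLittleO {A : ℝ} (hA : 1 < A) :
    (fun x : ℕ => (Real.log x / Real.log 2 + 1) * ((x : ℝ) / Real.log x ^ A)) =o[atTop]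
      fun x : ℕ => (x : ℝ) := by
  have hlog : Tendsto (fun x : ℕ => Real.log x) atTop atTop :=
    Real.tendsto_log_atTop.comp tendsto_natCast_atTop_atTop
  have h1 : Tendsto (fun x : ℕ => Real.log x ^ (-(A - 1))) atTop (𝓝 0) :=
    (tendsto_rpow_neg_atTop (by linarith)).comp hlog
  have h2 : Tendsto (fun x : ℕ => Real.log x ^ (-A)) atTop (𝓝 0) :=
    (tendsto_rpow_neg_atTop (by linarith)).comp hlog
  have hρ : Tendsto (fun x : ℕ => (Real.log x / Real.log 2 + 1) / Real.log x ^ A) atTop (𝓝 0) := by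
    have h3 : Tendsto (fun x : ℕ => Real.log x ^ (-(A - 1)) / Real.log 2 + Real.log x ^ (-A)) atTop
        (𝓝 (0 / Real.log 2 + 0)) := (h1.div_const _).add h2
    rw [zero_div, add_zero] at h3
    refine h3.congr' ?_
    filter_upwards [eventually_gt_atTop 1] with x hx
    have hlx : 0 < Real.log x := Real.log_pos (by exact_mod_cast hx)
    rw [Real.rpow_neg hlx.le, Real.rpow_neg hlx.le, Real.rpow_sub hlx, Real.rpow_one]
    field_simp
  have ho : (fun x : ℕ => (Real.log x / Real.log 2 + 1) / Real.log x ^ A) =o[atTop]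
      fun _ : ℕ => (1 : ℝ) := (isLittleO_one_iff ℝ).mpr hρ
  have := ho.mul_isBigO (isBigO_refl (fun x : ℕ => (x : ℝ)) atTop)
  refine this.congr' (Eventually.of_forall fun x => ?_) (Eventually.of_forall fun x => ?_)
  · show ((Real.log x / Real.log 2 + 1) / Real.log x ^ A) * (x : ℝ) = _
    ring
  · show (1 : ℝ) * (x : ℝ) = (x : ℝ)
    exact one_mul _

/-- **W1 · `stub_nonlinear_window_of_level` (registered stub of crux stmt-Parity-0870, skeleton
`Lines/stub_window_nonlinear.lean`): signed level of distribution of the `∏ μ log`-weighted root-count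
discrepancy on the power window `∏dᵢ ∈ [x^{1-c}, x^{1+c}]` with a log-power saving `A > 1` implies the
UNIFORM window `o(x)` for all `θ, η ∈ (0, min(c, 1/2)]`, for every Bateman–Horn system with a member of
degree `≥ 2` (the degree hypothesis is not used by the proof; it is part of the registered signature).**
See the module docstring for the proof. -/
theorem stub_nonlinear_window_of_level : ∀ (k : ℕ) (f : Fin k → ℤ[X]), IsBatemanHornSystem f →
    (∃ i, 2 ≤ (f i).natDegree) →
    (∃ c : ℝ, 0 < c ∧ ∃ A : ℝ, 1 < A ∧ ∃ x₀ : ℝ, ∀ x D D' : ℝ, x₀ ≤ x → x ^ (1 - c) ≤ D → D ≤ D' →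
        D' ≤ 2 * D → D ≤ x ^ (1 + c) →
        |∑ d ∈ Fintype.piFinset (fun _ : Fin k => Finset.Icc 1 ⌊D'⌋₊),
            (if D < ∏ i, (d i : ℝ) ∧ ∏ i, (d i : ℝ) ≤ D' then
              (∏ i, ((ArithmeticFunction.moebius (d i) : ℝ) * Real.log (d i))) *
                (((((Finset.Icc 1 ⌊x⌋₊).filter (fun n : ℕ =>
                    ∀ i, d i ∈ (((f i).eval (n : ℤ)).toNat).divisors)).card : ℕ) : ℝ) -
                  x * Summit.Parity.BatemanHorn.Theorems.TypeIMainTerm.sysDensity f d)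
            else 0)| ≤ x / Real.log x ^ A) →
    ∃ c : ℝ, 0 < c ∧ c < 1 ∧ ∀ θ η : ℝ, 0 < θ → θ ≤ c → 0 < η → η ≤ c →
      (fun x : ℕ => ∑ n ∈ Finset.Icc 1 x,
        ∑ d ∈ Fintype.piFinset (fun i => (((f i).eval (n : ℤ)).toNat).divisors),
          if (x : ℝ) ^ (1 - η) < ∏ i, (d i : ℝ) ∧ ∏ i, (d i : ℝ) ≤ (x : ℝ) ^ (1 + θ) then
            ∏ i, ((ArithmeticFunction.moebius (d i) : ℝ) * Real.log (d i)) else 0)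
        =o[atTop] fun x : ℕ => (x : ℝ) := by
  intro k f hf _hi hH
  obtain ⟨c, hc, A, hA, x₀, hH⟩ := hH
  refine ⟨min c (1 / 2), lt_min hc (by norm_num), (min_le_right _ _).trans_lt (by norm_num), ?_⟩
  intro θ η hθ0 hθc hη0 hηc
  have hθc' : θ ≤ c := hθc.trans (min_le_left _ _)
  have hηc' : η ≤ c := hηc.trans (min_le_left _ _)
  have hθh : θ ≤ 1 / 2 := hθc.trans (min_le_right _ _)
  have hηh : η ≤ 1 / 2 := hηc.trans (min_le_right _ _)
  have hη1 : η < 1 := by linarith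
  -- Step 1: exact swap and the split `W x = x * M x + E x`
  have hsplit : ∀ x : ℕ,
      (∑ n ∈ Finset.Icc 1 x, ∑ d ∈ Fintype.piFinset (fun i => (((f i).eval (n : ℤ)).toNat).divisors),
        if (x : ℝ) ^ (1 - η) < ∏ i, (d i : ℝ) ∧ ∏ i, (d i : ℝ) ≤ (x : ℝ) ^ (1 + θ) then
          ∏ i, ((ArithmeticFunction.moebius (d i) : ℝ) * Real.log (d i)) else 0) =
      (x : ℝ) * (∑ d ∈ Fintype.piFinset (fun _ : Fin k => Finset.Icc 1 ⌊(x : ℝ) ^ (1 + θ)⌋₊),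
          if (x : ℝ) ^ (1 - η) < ∏ i, (d i : ℝ) ∧ ∏ i, (d i : ℝ) ≤ (x : ℝ) ^ (1 + θ) then
            (∏ i, ((ArithmeticFunction.moebius (d i) : ℝ) * Real.log (d i))) * sysDensity f d else 0) +
        ∑ d ∈ Fintype.piFinset (fun _ : Fin k => Finset.Icc 1 ⌊(x : ℝ) ^ (1 + θ)⌋₊),
          (if (x : ℝ) ^ (1 - η) < ∏ i, (d i : ℝ) ∧ ∏ i, (d i : ℝ) ≤ (x : ℝ) ^ (1 + θ) then
            (∏ i, ((ArithmeticFunction.moebius (d i) : ℝ) * Real.log (d i))) *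
              (((((Finset.Icc 1 x).filter (fun n : ℕ =>
                  ∀ i, d i ∈ (((f i).eval (n : ℤ)).toNat).divisors)).card : ℕ) : ℝ) -
                (x : ℝ) * sysDensity f d) else 0) := by
    intro x
    rw [stub_windowSwap k f ((x : ℝ) ^ (1 - η)) ((x : ℝ) ^ (1 + θ)) x, Finset.mul_sum,
      ← Finset.sum_add_distrib]
    refine Finset.sum_congr rfl fun d _ => ?_
    split_ifs <;> ring
  -- Step 2: the main term
  have hmain := stub_windowMainTerm k f hf θ η hθ0 hη0 hη1
  -- Step 3: the error term, block by block
  have hE : (fun x : ℕ => ∑ d ∈ Fintype.piFinset (fun _ : Fin k => Finset.Icc 1 ⌊(x : ℝ) ^ (1 + θ)⌋₊),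
      (if (x : ℝ) ^ (1 - η) < ∏ i, (d i : ℝ) ∧ ∏ i, (d i : ℝ) ≤ (x : ℝ) ^ (1 + θ) then
        (∏ i, ((ArithmeticFunction.moebius (d i) : ℝ) * Real.log (d i))) *
          (((((Finset.Icc 1 x).filter (fun n : ℕ =>
              ∀ i, d i ∈ (((f i).eval (n : ℤ)).toNat).divisors)).card : ℕ) : ℝ) -
            (x : ℝ) * sysDensity f d) else 0)) =o[atTop] fun x : ℕ => (x : ℝ) := by
    refine IsBigO.trans_isLittleO (IsBigO.of_bound 1 ?_) (blocks_majorant_isLittleO hA)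
    have hx₀ : ∀ᶠ x : ℕ in atTop, x₀ ≤ (x : ℝ) := tendsto_natCast_atTop_atTop.eventually_ge_atTop x₀
    filter_upwards [hx₀, eventually_ge_atTop 2] with x hx₀x hx2
    have hx1 : (1 : ℝ) ≤ x := by exact_mod_cast (show 1 ≤ x by omega)
    have hx0 : (0 : ℝ) < x := by linarith
    have hlogx : 0 < Real.log x := Real.log_pos (by exact_mod_cast hx2)
    have hlog2 : 0 < Real.log 2 := Real.log_pos (by norm_num)
    -- the cut-offs
    set L : ℝ := (x : ℝ) ^ (1 - η) with hL
    set U : ℝ := (x : ℝ) ^ (1 + θ) with hU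
    have hL0 : 0 ≤ L := Real.rpow_nonneg hx0.le _
    have hL1 : (x : ℝ) ^ (1 - c) ≤ L := Real.rpow_le_rpow_of_exponent_le hx1 (by linarith)
    have hLU : L ≤ U := Real.rpow_le_rpow_of_exponent_le hx1 (by linarith)
    have hU1 : U ≤ (x : ℝ) ^ (1 + c) := Real.rpow_le_rpow_of_exponent_le hx1 (by linarith)
    have hU0 : 0 ≤ U := hL0.trans hLU
    -- the number of blocks
    set t : ℝ := (θ + η) * Real.log x / Real.log 2 with ht
    have ht0 : 0 ≤ t := by positivity
    set J : ℕ := ⌈t⌉₊ with hJ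
    have hJt : t ≤ J := Nat.le_ceil t
    have hJ1 : (J : ℝ) ≤ Real.log x / Real.log 2 + 1 := by
      have h1 : (J : ℝ) < t + 1 := Nat.ceil_lt_add_one ht0
      have h2 : t ≤ Real.log x / Real.log 2 := by
        rw [ht, div_le_div_iff_of_pos_right hlog2]
        nlinarith
      linarith
    have hUJ : U ≤ L * 2 ^ J := by
      have h1 : U = L * (x : ℝ) ^ (θ + η) := by
        rw [hU, hL, ← Real.rpow_add hx0]
        ring_nf
      rw [h1]
      refine mul_le_mul_of_nonneg_left ?_ hL0
      have h2 : (x : ℝ) ^ (θ + η) = Real.exp ((θ + η) * Real.log x) := by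
        rw [Real.rpow_def_of_pos hx0]; ring_nf
      have h3 : (2 : ℝ) ^ J = Real.exp ((J : ℝ) * Real.log 2) := by
        rw [← Real.rpow_natCast, Real.rpow_def_of_pos (by norm_num : (0 : ℝ) < 2)]; ring_nf
      rw [h2, h3, Real.exp_le_exp]
      have := mul_le_mul_of_nonneg_right hJt hlog2.le
      rw [ht, div_mul_cancel₀ _ hlog2.ne'] at this
      linarith
    -- abbreviation for the error weight
    set g : (Fin k → ℕ) → ℝ := fun d =>
      (∏ i, ((ArithmeticFunction.moebius (d i) : ℝ) * Real.log (d i))) *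
        (((((Finset.Icc 1 x).filter (fun n : ℕ =>
            ∀ i, d i ∈ (((f i).eval (n : ℤ)).toNat).divisors)).card : ℕ) : ℝ) -
          (x : ℝ) * sysDensity f d) with hg
    -- each block is bounded by the hypothesis
    have hblock : ∀ j : ℕ, |∑ d ∈ Fintype.piFinset (fun _ : Fin k => Finset.Icc 1 ⌊U⌋₊),
        (if min (L * 2 ^ j) U < ∏ i, (d i : ℝ) ∧ ∏ i, (d i : ℝ) ≤ min (L * 2 ^ (j + 1)) U then g d
          else 0)| ≤ (x : ℝ) / Real.log x ^ A := by
      intro j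
      have hDj0 : 0 ≤ L * 2 ^ j := by positivity
      have hD'0 : 0 ≤ min (L * 2 ^ (j + 1)) U := le_min (by positivity) hU0
      have hD'U : min (L * 2 ^ (j + 1)) U ≤ U := min_le_right _ _
      have hDD' : min (L * 2 ^ j) U ≤ min (L * 2 ^ (j + 1)) U :=
        min_le_min (mul_le_mul_of_nonneg_left (pow_le_pow_right₀ (by norm_num) (by omega)) hL0) le_rfl
      have hD'2D : min (L * 2 ^ (j + 1)) U ≤ 2 * min (L * 2 ^ j) U := by
        rcases le_total (L * 2 ^ j) U with h | h
        · rw [min_eq_left h]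
          calc min (L * 2 ^ (j + 1)) U ≤ L * 2 ^ (j + 1) := min_le_left _ _
            _ = 2 * (L * 2 ^ j) := by ring
        · rw [min_eq_right h]
          calc min (L * 2 ^ (j + 1)) U ≤ U := min_le_right _ _
            _ ≤ 2 * U := by linarith
      have hDlow : (x : ℝ) ^ (1 - c) ≤ min (L * 2 ^ j) U := by
        refine le_min (hL1.trans ?_) (hL1.trans hLU)
        have : (1 : ℝ) ≤ 2 ^ j := one_le_pow₀ (by norm_num)
        nlinarith
      have hDup : min (L * 2 ^ j) U ≤ (x : ℝ) ^ (1 + c) := (min_le_right _ _).trans hU1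
      have hHx := hH (x : ℝ) (min (L * 2 ^ j) U) (min (L * 2 ^ (j + 1)) U) hx₀x hDlow hDD' hD'2D hDup
      simp only [Nat.floor_natCast] at hHx
      rw [← stub_windowBoxChange k g (min (L * 2 ^ j) U) (min (L * 2 ^ (j + 1)) U) U hD'0 hD'U]
      exact hHx
    -- sum the blocks
    rw [one_mul, Real.norm_eq_abs, Real.norm_eq_abs,
      stub_windowBlocks k _ (fun d => ∏ i, (d i : ℝ)) g L U J hL0 hLU hUJ]
    have hpos : 0 ≤ (Real.log x / Real.log 2 + 1) * ((x : ℝ) / Real.log x ^ A) := by positivity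
    rw [abs_of_nonneg hpos]
    calc |∑ j ∈ Finset.range J, ∑ d ∈ Fintype.piFinset (fun _ : Fin k => Finset.Icc 1 ⌊U⌋₊),
            (if min (L * 2 ^ j) U < ∏ i, (d i : ℝ) ∧ ∏ i, (d i : ℝ) ≤ min (L * 2 ^ (j + 1)) U then g d
              else 0)|
        ≤ ∑ j ∈ Finset.range J, |∑ d ∈ Fintype.piFinset (fun _ : Fin k => Finset.Icc 1 ⌊U⌋₊),
            (if min (L * 2 ^ j) U < ∏ i, (d i : ℝ) ∧ ∏ i, (d i : ℝ) ≤ min (L * 2 ^ (j + 1)) U then g d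
              else 0)| := Finset.abs_sum_le_sum_abs _ _
      _ ≤ ∑ _j ∈ Finset.range J, (x : ℝ) / Real.log x ^ A := Finset.sum_le_sum fun j _ => hblock j
      _ = (J : ℝ) * ((x : ℝ) / Real.log x ^ A) := by rw [Finset.sum_const, Finset.card_range, nsmul_eq_mul]
      _ ≤ (Real.log x / Real.log 2 + 1) * ((x : ℝ) / Real.log x ^ A) :=
          mul_le_mul_of_nonneg_right hJ1 (by positivity)
  -- Step 4: assemble
  exact (hmain.add hE).congr_left fun x => (hsplit x).symm

end Summit.Parity.BatemanHorn.Theorems.PolyMobiusTail.NonlinearWindow
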